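import Summits.AtomisticToContinuum.Crystallization.Theses.PalmUnimodularRigidity
import Summits.AtomisticToContinuum.Crystallization.Theorems.ShellsToBarlowChart.Negative.ScaleWindow
import Literature.Geometry.DiscreteGeometry.LayerStackings
import Literature.Geometry.DiscreteGeometry.KissingRigidity

/-!
# Line `distance-sweep-development` — skeleton for crux `ShellsToBarlowChart`
(item `stmt-AtomisticToContinuum-9227`, route `PalmUnimodularRigidity`, sub-problem `Crystallization`)

Crux (route decl, verbatim): a non-empty `S ⊆ ℝ³` in which EVERY point `x` has a
`(a_x/100)`-matched FCC- or HCP-shaped shell at its own scale `a_x ∈ [9/10, 1]` (the shell being ALL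
of `S ∖ {x}` within `5a_x/4`) is bond-isomorphic to an ideal Barlow stacking
`barlowStacking 1 √(2/3) s` for SOME `±1` word `s` (bond = distance in `(0, 28/25]`).

## The line (card `Ideas/distance-sweep-development.md`, triage r1-1/2/3: pass ×3)

Develop `S` into `ℝ³` EXACTLY, atom by atom, in order of Euclidean distance from a base atom `v₀`:
when the sweep reaches `v` at radius `r = |v − v₀| > 2`, its already-developed neighbours
`P(v) = N(v) ∩ B(v₀, r)` are (the labels of) a half-space section `{p : ⟪u, p⟫ > c}` of `v`'s link
pattern with `c ≤ 1.0201·a_v/(2r) + 1/100 ≤ 0.2651`, blurred by `≤ 0.03`; every such section is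
CONNECTED in the contact graph, spans `ℝ³` together with the centre, and every blurred-boundary
point is adjacent to it (`CapLemma`, finite, verified numerically in `compute/capverify.py`:
2·10⁶ + 650 critical directions per pattern, 0 failures; walls `arccos √(2/11) = 64.76°` (fcc),
`arccos (√3/6) = 73.2213°` (hcp) against the stated `arccos 0.27 = 74.34°`).  Exact local charts
(`LocalCharts`: a development exact on the stars of all atoms within distance `2` of a given atom —
the graph `3`–`4`-ball) pinned on the developed part of a star therefore agree at `v` along the
connected `P(v)` (two exact developments of one star differ by an isometry: `fcc_rigid`/`hcp_rigid`
in tree), so `D(v)` is well defined and the invariant "on the developed part of every closed star,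
`D` is an isometric copy of an exact chart" propagates (`stub_sweep`, the lever: an `ω`-recursion
over a locally finite set, no paths, loops or cells).  The output is a LOCALLY EXACT development
(`SweepDevelopment`, the Transfer target `C⁺`: strictly weaker than the crux — no injectivity);
injectivity / `1`-separation / bond-faithfulness is the shared lifting step (`RadialLifting`, shared
with line `flat-radial-development`), and an exact development gives the chart by Hales's theorem
`HalesDSP_layerPackings_holds` (in tree) applied to `2 • D '' S` (`DevelopedChart`, shared, M).

## Registered stubs (5) and composition

* `stub_capLemma      : CapLemma`                                   — finite (S/M).
* `stub_localCharts   : LocalCharts`                                — local, the only place the `1 %` is spent (M/L).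
* `stub_sweep         : CapLemma → LocalCharts → SweepDevelopment`  — THE LEVER (L).
* `stub_radialLifting : RadialLifting`                              — shared global step (L/XL, largest).
* `stub_developedChart: DevelopedChart`                             — shared end-game over Hales (M, provable now).
* `compose : CapLemma → LocalCharts → (CapLemma → LocalCharts → SweepDevelopment) → RadialLifting →
    DevelopedChart → ∀ S, S.Nonempty → EveryPointGood S → ChartConclusion S` — the glue, PROVED (no sorry);
  `ShellsToBarlowChart_of : PalmUnimodularRigidity.ShellsToBarlowChart := shellsToBarlowChart_iff.2 (compose stub_…)`
  — concludes the route decl BY NAME from the five registered stubs (the unique crux-concluding theorem here).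

## Disproof used (standing disprover, `Cruxes/ShellsToBarlowChart/Disproof.lean`, cycles 1–2; landed as
`Theorems/ShellsToBarlowChart/Negative/{Calibration,ScaleWindow,Tolerance}.lean`; the first two are imported
here, `Tolerance.lean` (`shellsToBarlowChart_false_tol_eighth`, `equatorPropagation_margin`,
`hardCore_bounds`) is cited by name only — it was not yet built on the farm when this skeleton was checked)

* `shellsToBarlowChart_false_without_nonempty` — honoured: `SweepDevelopment` and `DevelopedChart`
  carry `S.Nonempty` (the sweep needs its base atom `v₀`; Hales needs `V.Nonempty`).
* `…_false_without_scaleUpper`, `…_false_without_scaleLower`, `…_false_subshell`,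
  `…_false_tol_eighth` — honoured: every stub that touches `S` takes the VERBATIM per-point
  hypothesis `EveryPointGood` (window `[9/10,1]`, tolerance `a/100`, `↑T =` the whole `5a/4`-ball),
  and all four enter through "window graph = shell graph, links exact" (`margins`), used in
  `stub_localCharts` (charts are indexed by bonds), `stub_sweep` (the cap identification of `P(v)`
  uses `v`'s own matching and `|y − v| ∈ [0.99, 1.01]·a_v`) and `stub_radialLifting` (hard core /
  covering radius).  The `examples` in § Disproof-used below CHECK that our packaging is
  definitionally the disprover's (`Iff.rfl`).
* `not_shellsToFccChart` (the Hägg word is load-bearing) — respected: `ExactStar` allows the FCC or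
  the HCP pattern at every point independently; the word is whatever Hales's theorem returns.
* Calibration `hypothesis_barlowStacking` — checked below: ideal stackings satisfy `EveryPointGood`,
  so no stub with hypothesis `EveryPointGood` is vacuous.
* Refuted METRIC strengthenings of the Disproof's item (c) (log-spiral frame drift, two NN
  distances) — respected: no stub compares frames or scales of far-apart atoms; `RadialLifting`
  claims injectivity, never coarse conformality (the card's rejected stronger transfer).
* Landed negatives of the summit consulted: stmt-4146 (`EffectiveLocalHales`, D₅ₕ soft shell) and
  stmt-3506 (`OneGrainGluing`) do not meet `EveryPointGood`; no stub is an instance of either.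
-/

namespace Summit.AtomisticToContinuum.Crystallization.Cruxes.ShellsToBarlowChart.DistanceSweepDevelopment

open Literature.Geometry.DiscreteGeometry Literature.MathematicalPhysics.StatisticalMechanics
open scoped Classical

/-- Euclidean `3`-space. -/
local notation "E3" => EuclideanSpace ℝ (Fin 3)

/-! ## The crux, unpacked (definitionally: see `shellsToBarlowChart_iff`) -/

/-- The crux hypothesis at one point `x` with an explicit scale `a` (verbatim shape of the route
decl): the recentred `5a/4`-shell of `x` in `S` is `(a/100)`-matched, after a linear isometry, to
the `a`-scaled FCC or HCP kissing pattern. -/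
def GoodShellAt (S : Set E3) (x : E3) (a : ℝ) : Prop :=
  ∃ T : Finset E3, (↑T : Set E3) = (fun y : E3 => y - x) '' {y : E3 | y ∈ S ∧ y ≠ x ∧ dist y x ≤ 5 / 4 * a} ∧
    (ShellCloseTo (a / 100) T (Finset.image (fun v : E3 => a • v) fccKissingPattern) ∨
     ShellCloseTo (a / 100) T (Finset.image (fun v : E3 => a • v) hcpKissingPattern))

/-- The crux hypothesis, verbatim: every point of `S` has a `1 %`-good shell at its own scale
`a ∈ [9/10, 1]`. -/
def EveryPointGood (S : Set E3) : Prop :=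
  ∀ x ∈ S, ∃ a : ℝ, 9 / 10 ≤ a ∧ a ≤ 1 ∧ GoodShellAt S x a

/-- The crux conclusion for `S`, verbatim: a bond-isomorphism with an ideal Barlow stacking. -/
def ChartConclusion (S : Set E3) : Prop :=
  ∃ s : ℤ → ℤ, IsHaggSeq s ∧ ∃ Φ : E3 → E3, Set.BijOn Φ (barlowStacking 1 (Real.sqrt (2 / 3)) s) S ∧
    ∀ p ∈ barlowStacking 1 (Real.sqrt (2 / 3)) s, ∀ q ∈ barlowStacking 1 (Real.sqrt (2 / 3)) s,
      (dist p q = 1 ↔ (0 < dist (Φ p) (Φ q) ∧ dist (Φ p) (Φ q) ≤ 28 / 25))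

/-- The route decl IS `∀ S, S.Nonempty → EveryPointGood S → ChartConclusion S` (definitional). -/
theorem shellsToBarlowChart_iff :
    Summit.AtomisticToContinuum.Crystallization.Theses.PalmUnimodularRigidity.ShellsToBarlowChart ↔
      ∀ S : Set E3, S.Nonempty → EveryPointGood S → ChartConclusion S :=
  Iff.rfl

/-! ## Bonds, exact stars, developments -/

/-- A BOND: two points at distance in the conclusion's window `(0, 28/25]`.  For an every-point-good
`S` the bonds at `x` are exactly its twelve shell points (Disproof `margins`: shell points are
`≤ 1.01·a ≤ 1.0100` away, everything else `> 5a/4 ≥ 1.125 > 28/25`). -/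
def IsBond (x y : E3) : Prop := 0 < dist x y ∧ dist x y ≤ 28 / 25

/-- `ψ` is an EXACT STAR MAP at `y` (w.r.t. `S`): recentred at `ψ y`, it carries the bond-neighbours
of `y` in `S` bijectively onto a rotated copy of the unit FCC or HCP kissing pattern, AND it is
bond-faithful on that star (two neighbours of `y` are bonded iff their images are at distance
exactly `1`).  The second clause makes the labelled image a realization of the exact link graph, so
that two exact star maps at the same point differ by an isometry on the closed star
(`KissingRigidity.fcc_rigid` / `hcp_rigid`, Hales 2012 Lemma 10, in tree). -/
def ExactStar (S : Set E3) (ψ : E3 → E3) (y : E3) : Prop :=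
  (∃ A : E3 →ₗᵢ[ℝ] E3,
      Set.BijOn (fun z : E3 => ψ z - ψ y) {z : E3 | z ∈ S ∧ IsBond y z} (A '' (fccKissingPattern : Set E3)) ∨
      Set.BijOn (fun z : E3 => ψ z - ψ y) {z : E3 | z ∈ S ∧ IsBond y z} (A '' (hcpKissingPattern : Set E3))) ∧
  ∀ z ∈ S, ∀ z' ∈ S, IsBond y z → IsBond y z' → (IsBond z z' ↔ dist (ψ z) (ψ z') = 1)

/-- A LOCALLY EXACT DEVELOPMENT of `S`: one map `D : ℝ³ → ℝ³` that is an exact star map at every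
point of `S` (adjacent stars are glued automatically — it is one map; NO injectivity, separation or
bond-faithfulness across non-adjacent stars is claimed).  This is the Transfer target `C⁺` of the
card: strictly weaker than the crux. -/
def LocallyExactDevelopment (S : Set E3) (D : E3 → E3) : Prop :=
  ∀ x ∈ S, ExactStar S D x

/-- An EXACT DEVELOPMENT of `S`: `1`-separated on `S` (hence injective), bond-faithful (bond ↔
developed distance exactly `1`), and with EXACT FCC/HCP distance-`1` shells in the image.  This is
precisely what Hales's theorem consumes after doubling (`DevelopedChart`). -/
def IsExactDevelopment (S : Set E3) (D : E3 → E3) : Prop :=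
  (∀ x ∈ S, ∀ y ∈ S, x ≠ y → 1 ≤ dist (D x) (D y)) ∧
  (∀ x ∈ S, ∀ y ∈ S, (IsBond x y ↔ dist (D x) (D y) = 1)) ∧
  (∀ x ∈ S, ∃ A : E3 →ₗᵢ[ℝ] E3,
      {z : E3 | z ∈ D '' S ∧ dist z (D x) = 1} = (fun p : E3 => D x + A p) '' (fccKissingPattern : Set E3) ∨
      {z : E3 | z ∈ D '' S ∧ dist z (D x) = 1} = (fun p : E3 => D x + A p) '' (hcpKissingPattern : Set E3))

/-! ## The five stub statements -/

/-- **CAP LEMMA** (finite; sandwich form, the shape the sweep step consumes).  For the unit FCC or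
HCP kissing pattern `P`, a unit vector `u` and thresholds `lo ≤ hi` with `−1/10 ≤ lo`,
`hi ≤ 27/100`, `hi − lo ≤ 1/20`, put `I = {p ∈ P : hi < ⟪u,p⟫}` (inner cap = neighbours of the new
atom `v` certainly developed before `v`) and `O = {p ∈ P : lo ≤ ⟪u,p⟫}` (outer cap = possibly
developed).  Then (a) `I` contains three linearly independent vectors (so `{v} ∪ P(v)` affinely
spans `ℝ³` — the pinning rank the sweep needs), (b) `I` is connected in the contact graph
(`dist = 1`), (c) every point of the annulus `O ∖ I` is adjacent to a point of `I` (so every set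
sandwiched between `I` and `O` is connected).  Why plausibly true: (b) is a Balinski-type monotone
path property of the `1`-skeleta of the cuboctahedron / `J27` under a linear functional; (a) fails
first at `hi = √3/6 = 0.2887` (hcp: `u ∝ (−1,2,−1)` in `hcpInt` coordinates sees two equator points,
then four cap points at exactly `73.2213°`) resp. `√(2/11)` (fcc); all three verified numerically for
the stated constants (`compute/capverify.py`: 2·10⁶ grid + 650/146 exact critical directions with
perturbations, 0 failures; sanity: `hi ≤ 0.29` correctly FAILS (a)).  Lean route: clear
denominators (`fccInt`, `hcpInt` integer tables; the sections are threshold sets of integer linear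
forms) or a structural proof via the face structure.  Size S/M. -/
def CapLemma : Prop :=
  ∀ P ∈ ({fccKissingPattern, hcpKissingPattern} : Set (Finset E3)), ∀ u : E3, ‖u‖ = 1 →
    ∀ lo hi : ℝ, -(1 / 10) ≤ lo → lo ≤ hi → hi ≤ 27 / 100 → hi - lo ≤ 1 / 20 →
      (∃ p ∈ P, ∃ q ∈ P, ∃ s ∈ P, hi < inner ℝ u p ∧ hi < inner ℝ u q ∧ hi < inner ℝ u s ∧
          LinearIndependent ℝ ![p, q, s]) ∧
      (∀ R : Finset E3, R ⊆ P.filter (fun p => hi < inner ℝ u p) → R.Nonempty →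
          R ≠ P.filter (fun p => hi < inner ℝ u p) →
          ∃ p ∈ R, ∃ q ∈ P.filter (fun p => hi < inner ℝ u p), q ∉ R ∧ dist p q = 1) ∧
      (∀ p ∈ P, lo ≤ inner ℝ u p → inner ℝ u p ≤ hi → ∃ q ∈ P, hi < inner ℝ u q ∧ dist p q = 1)

/-- **LOCAL CHARTS** (the local lemma; the ONLY place the `1 %` tolerance is spent).  For every atom
`x` of an every-point-good `S` there is a map `ψ : ℝ³ → ℝ³` that is an exact star map at EVERY atom
within (absolute) distance `2` of `x` — an exact development of the union of those closed stars
(contained in the graph `4`-ball of `x`; radius `2` is what the sweep's base needs, and `N[x]` is what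
its step needs).  Why plausibly true: after the Disproof's `margins` the bond graph is locally the
exact cuboctahedron / anticuboctahedron graph; straighten the star of `x` (its matching), extend
across each bond `{y, y'}` by the unique isometry matching the two straightened labelled
`6`-configurations `{y, y', 4 common neighbours}` (same induced common-neighbour graph — perfect
matching for TOTO edges, path + isolated point for TTOO (hcp-equatorial) edges — and both `2 %`-close
to similar copies of the actual six points, hence congruent as LABELLED configurations), and observe
that positions reached twice coincide (both predictions lie on the same `4`-position circle about a
bond, or are the same octahedron apex — the disprover's cycle-2 local-rigidity analysis
`equatorPropagation_margin`, C5/D5 enumerations, and the gen-2 card `link-recognition`'s radius-2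
amalgam certificate "6 free classes, 0 exotic" are three independent confirmations that no exotic
local continuation exists at `1 %`; first metric ambiguity at `η ≥ 0.0646`).  Why it might fail: a
consistency case at graph radius `3–4` needing information beyond the two straightened stars (none
known; the every-point hypothesis is available at every atom met).  Size M/L. -/
def LocalCharts : Prop :=
  ∀ S : Set E3, EveryPointGood S → ∀ x ∈ S, ∃ ψ : E3 → E3, ∀ y ∈ S, dist y x ≤ 2 → ExactStar S ψ y

/-- **SWEEP DEVELOPMENT** (the Transfer target `C⁺`): every non-empty every-point-good `S` admits a
locally exact development. -/
def SweepDevelopment : Prop :=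
  ∀ S : Set E3, S.Nonempty → EveryPointGood S → ∃ D : E3 → E3, LocallyExactDevelopment S D

/-- **RADIAL LIFTING** (shared with line `flat-radial-development`, its step D2): a locally exact
development of an every-point-good set is an exact development.  Proof plan (triage-checked):
bonds = shells and `S` is Delone (covering radius `≤ 0.7215·a`, hard core `0.891`); the canonical
Delaunay cells of `S` are bond tetrahedra / pieces of bond octahedra (margins `≥ 0.4a` vs `0.05a`) and
tile `ℝ³` (`DelaunaySubdivision.biUnion_convexHull_delaunayCells_of_covering`, in tree); extend `D`
cellwise-affinely to `D̂ : ℝ³ → ℝ³`, a local homeomorphism (stars go to exact stars, orientation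
coherent along the connected bond graph) that is uniformly locally bi-Lipschitz; completeness makes
`D̂` a covering of `ℝ³`, hence a homeomorphism (radial lifting of model segments from `D v₀`, or
`IsCoveringMap` + simple connectivity); the image cells are unit regular tetrahedra/octahedra tiling
space face-to-face with Barlow vertex stars, which gives `1`-separation, bond-faithfulness and exact
image shells.  Why it might fail: only through Lean cost (PL extension + covering argument); the
statement holds for every locally exact development.  Size L/XL (largest stub of the line). -/
def RadialLifting : Prop :=
  ∀ S : Set E3, EveryPointGood S → ∀ D : E3 → E3, LocallyExactDevelopment S D → IsExactDevelopment S D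

/-- **DEVELOPED CHART** (shared end-game, provable now, size M): an exact development of a non-empty
set yields the chart.  Proof plan: `V := (2 • ·) '' (D '' S)` is an `IsUnitBallPacking` by
`1`-separation, `kissingShell V (2 • D x) = (fun p => 2 • A p) '' P` is literally `IsArrangedIn`, so
`HasFccOrHcpShells V`; `HalesDSP_layerPackings_holds` (tree, `LayerStackings.lean:412`) gives
`V = g '' barlowStacking 2 (2√(2/3)) s`; put `Φ p := D⁻¹ (½ • g (2 • p))` (`smul_barlowPos`, landed in
`Negative/Calibration.lean`) and read `dist p q = 1 ↔ dist (D (Φ p)) (D (Φ q)) = 1 ↔ IsBond` off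
bond-faithfulness. -/
def DevelopedChart : Prop :=
  ∀ S : Set E3, S.Nonempty → ∀ D : E3 → E3, IsExactDevelopment S D → ChartConclusion S

/-! ## Registered stubs -/

/-- stub (finite, S/M): the cap lemma in sandwich form — see `CapLemma`. -/
theorem stub_capLemma : CapLemma := by
  sorry

/-- stub (local, M/L): exact charts on the stars of all atoms within distance `2` — see
`LocalCharts`. -/
theorem stub_localCharts : LocalCharts := by
  sorry

/-- stub (THE LEVER, L): the distance sweep.  Given the cap lemma and local charts, build `D` by
recursion along an enumeration `v₀, v₁, …` of `S` with `|v_n − v₀|` non-decreasing (`S` is uniformly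
discrete, so every ball is finite).  BASE: `D := ψ₀` (the chart of `stub_localCharts` at `v₀`) on
`S ∩ B[v₀, 2]`.  STEP (`r = |v − v₀| > 2 ≥ 2a_v`): with `v`'s matching `y = v + a_v B p_y + e_y`
(`|e_y| ≤ a_v/100`), `y` is developed iff `⟪B p_y, d̂⟫ > c_y`, `d̂ = (v₀ − v)/r`,
`c_y = |y − v|²/(2 r a_v) − ⟪e_y, d̂⟫/a_v ∈ [0.9801·a_v/(2r) − 0.01, 1.0201·a_v/(2r) + 0.01] ⊆ [−0.01, 0.2651]`,
width `≤ 0.03`: so `P(v)` is sandwiched as in `CapLemma` — non-empty, connected, and `{v} ∪ P(v)`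
affinely spanning.  Put `D v := g_w (ψ_w v)` for `w ∈ P(v)`, where the INVARIANT supplies, for every
developed `x`, an isometry `g_x` with `D = g_x ∘ ψ_x` on `{x} ∪ (Dev ∩ N(x)) ∪ {developed second
neighbours of x sharing a developed common neighbour with x}` (`ψ_x` = local chart at `x`, exact on
`N[x]`).  Well-definedness along an edge `w ~ w'` of `P(v)`: `g_w ψ_w` and `g_w' ψ_w'` are both exact
star maps at `w` and at `w'`, hence differ by ONE isometry `h` on `N[w] ∪ N[w']` (single-star rigidity
from `fcc_rigid`/`hcp_rigid` twice, glued on the affinely spanning `{w, w', 4 common neighbours}`);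
both agree with `D` on `Dev ∩ N[w] ⊇ {w} ∪ P(w)`, affinely spanning (cap lemma (a) at `w`, or the base
geometry for `|w − v₀| ≤ 2`), so `h = id` and they agree at `v ∈ N[w]`; chain along connected `P(v)`.
The invariant re-establishes itself at `v` (take `g_v` with `g_v ψ_v = g_w ψ_w` on `N[v]`, independent
of `w` by the same gluing) and at the old points (new pairs are reconciled through the double stars
`N[x] ∪ N[w]`).  Output: `D` is an exact star map at every atom (each closed star is eventually
developed and `D = g_x ψ_x` on it).  Uses `S.Nonempty` (base atom) and the verbatim hypothesis
(bonds = shells, `a_v ≤ 1`, tolerance `1/100`) — the Disproof's four load-bearing lemmas.  Why it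
might fail: bookkeeping of the base/step interface at `r ≈ 2` (handled: base pinning sets
`N[w] ∩ B[v₀,2]` are caps with threshold `≤ 0.2525 + 0.01 < 0.27`).  Size L. -/
theorem stub_sweep : CapLemma → LocalCharts → SweepDevelopment := by
  sorry

/-- stub (shared global step, L/XL): locally exact ⇒ exact — see `RadialLifting`. -/
theorem stub_radialLifting : RadialLifting := by
  sorry

/-- stub (shared end-game, M): exact development ⇒ chart, by `HalesDSP_layerPackings_holds` — see
`DevelopedChart`. -/
theorem stub_developedChart : DevelopedChart := by
  sorry

/-! ## Composition: the five stub statements prove the crux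

`compose` is the sorry-free glue `stub₁-statement → … → stub₅-statement → (the crux, unpacked)`;
`ShellsToBarlowChart_of` applies it to the five registered stubs and concludes the route decl BY NAME
(it is the only theorem of this file whose conclusion is the crux, so the skeleton audit reads it; its
axiom closure is `propext, Classical.choice, Quot.sound` + the stubs' `sorryAx`). -/

/-- **The glue of the line** (kernel-checked, no `sorry`): the five stub statements imply the crux in
its unpacked form `∀ S, S.Nonempty → EveryPointGood S → ChartConclusion S` (which IS the route decl,
`shellsToBarlowChart_iff`). -/
theorem compose :
    CapLemma → LocalCharts → (CapLemma → LocalCharts → SweepDevelopment) → RadialLifting →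
      DevelopedChart → ∀ S : Set E3, S.Nonempty → EveryPointGood S → ChartConclusion S := by
  intro hcap hloc hsweep hlift hend S hne hgood
  obtain ⟨D, hD⟩ := hsweep hcap hloc S hne hgood
  exact hend S hne D (hlift S hgood D hD)

/-- The same glue with the conclusion spelled as the route decl (definitional unfolding only). -/
example :
    CapLemma → LocalCharts → (CapLemma → LocalCharts → SweepDevelopment) → RadialLifting →
      DevelopedChart →
        Summit.AtomisticToContinuum.Crystallization.Theses.PalmUnimodularRigidity.ShellsToBarlowChart :=
  fun hcap hloc hsweep hlift hend => shellsToBarlowChart_iff.2 (compose hcap hloc hsweep hlift hend)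

/-- **The line closes the crux BY NAME**: the five registered stubs, composed by `compose`.  The only
`sorry`s in its closure are the five `stub_*`. -/
theorem ShellsToBarlowChart_of :
    Summit.AtomisticToContinuum.Crystallization.Theses.PalmUnimodularRigidity.ShellsToBarlowChart :=
  shellsToBarlowChart_iff.2
    (compose stub_capLemma stub_localCharts stub_sweep stub_radialLifting stub_developedChart)

/-! ## Disproof used — checked cross-references to the landed negative lemmas

Our packaging of hypothesis and conclusion is DEFINITIONALLY the disprover's window-`[9/10,1]`
packaging, so every `false_without` lemma applies verbatim to any weakening a prover might be
tempted by, and the calibration shows the stubs' hypothesis class is far from vacuous. -/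

section DisproofUsed

open Summit.AtomisticToContinuum.Crystallization.Theorems

/-- `EveryPointGood` at a point = the disprover's `GoodShellAt (9/10) 1`. -/
example (S : Set E3) (x : E3) :
    (∃ a : ℝ, 9 / 10 ≤ a ∧ a ≤ 1 ∧ GoodShellAt S x a) ↔
      ShellsToBarlowChartNegative.GoodShellAt (9 / 10) 1 S x :=
  Iff.rfl

/-- `ChartConclusion` = the disprover's `BarlowChart`. -/
example (S : Set E3) : ChartConclusion S ↔ ShellsToBarlowChartNegative.BarlowChart S := Iff.rfl

/-- The crux = the disprover's scaled crux at `(9/10, 1)` = our unpacking. -/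
example : (∀ S : Set E3, S.Nonempty → EveryPointGood S → ChartConclusion S) ↔
    ShellsToBarlowChartNegative.ShellsToBarlowChartScaled (9 / 10) 1 := Iff.rfl

/-- Load-bearing (any proof of `stub_sweep`/`stub_radialLifting` must use them): both ends of the
scale window (non-emptiness and exclusivity of the `5a/4`-shell are `shellsToBarlowChart_false_without_nonempty`
and `shellsToBarlowChart_false_subshell` of the same file, stated against unnamed weakenings). -/
example : ¬ ShellsToBarlowChartNegative.ShellsToBarlowChartScaled (9 / 10) 2 :=
  ShellsToBarlowChartNegative.shellsToBarlowChart_false_without_scaleUpper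

example : ¬ ShellsToBarlowChartNegative.ShellsToBarlowChartScaled (1 / 2) 1 :=
  ShellsToBarlowChartNegative.shellsToBarlowChart_false_without_scaleLower

-- `Negative/Tolerance.lean` (cited, not imported — see the module docstring):
--   `shellsToBarlowChart_false_tol_eighth : ¬ ShellsToBarlowChartTol (1 / 8)` (tolerance load-bearing
--   only through the bond window, from `η > 3/25`), `equatorPropagation_margin`, `hardCore_bounds`.

/-- Calibration: the hypothesis of `SweepDevelopment` / `RadialLifting` / `LocalCharts` is met by
every ideal stacking at every scale `c ∈ [9/10, 1]` (so none of these stubs is vacuous, and the sweep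
must — and does — return an ARBITRARY Hägg word). -/
example {s : ℤ → ℤ} (hs : IsHaggSeq s) {c : ℝ} (h9 : 9 / 10 ≤ c) (h1 : c ≤ 1) :
    (barlowStacking c (c * Real.sqrt (2 / 3)) s).Nonempty ∧
      EveryPointGood (barlowStacking c (c * Real.sqrt (2 / 3)) s) :=
  ShellsToBarlowChartNegative.hypothesis_barlowStacking hs h9 h1

/-- The end-game's only external input exists in tree (Hales, Dense Sphere Packings §1.3). -/
example : HalesDSP_layerPackings := HalesDSP_layerPackings_holds

/-- Single-star rigidity is in tree (Hales 2012, Lemma 10): every realization of the FCC contact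
graph is a linear-isometric image of the reference pattern (and likewise `hcp_rigid`). -/
example {σ : ℝ} {x : Fin 12 → E3} (hx : IsRealization fccAdj σ x) :
    ∃ A : E3 →ₗᵢ[ℝ] E3, ∀ i, A (fccRef i) = x i :=
  fcc_rigid hx

end DisproofUsed

end Summit.AtomisticToContinuum.Crystallization.Cruxes.ShellsToBarlowChart.DistanceSweepDevelopment
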